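import Literature.IUT.HodgeTheaters.PiAvatarLocalAmbient
import HarnessLib

/-!
# KIT-INSTANCE-SPEC P5-binding, LOCAL slots (IV): the kit slot `labOfHom` — the map on `±`-label classes of cusps induced by a morphism
# `†𝒟_v̲ → †𝒟^{⊚±}` — and its laws `labOfHom_pre`, `labOfHom_post`, `labOfHom_phiEll = id` over a `LocalDatum`
# ([IUTchI] Ex 6.3 (i), Prop 6.5 (i); defs — post-freeze additive D13, not a cone member)

S. Mochizuki, *Inter-universal Teichmüller theory I*, kurims manuscript (May 2020), Prop 6.5 (i) p. 163 («the `𝒟-Θ^{ell}`-bridge … induces a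
bijection of sets of ±-label classes of cusps `LabCusp^±(†𝒟_{v_t}) ⥲ LabCusp^±(†𝒟^{⊚±})` … compatible with the respective `𝔽_l^±`-torsor
structures»), Ex 6.3 (i) p. 161 (`φ^{Θell}_{v̲_t}` = `β ∘ φ^{Θell}_{•,v̲} ∘ α`, «by post-composing `φ^{Θell}_0` with the poly-action of `t` on
`𝒟^{⊚±}`») ([IUTchI] Prop 6.5 (i) p.163) [claim: Mochizuki2012, status: disputed] (D-0012 claim key, series status DISPUTED — definitions
and kernel theorems over abc-iut-L5-t2's REAL `InitialThetaData`, abc-iut-L5-t1's `CuspGalois`, under the binders `hS` and the local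
arrow law carried by the `LocalDatum` (p440701/p442681); nothing of the series is asserted, no side is taken on [IUTchIII] Cor. 3.12).

## What is built (for `δ : D.LocalDatum CG hS`)
* `LocalDatum.baseCoset` / `exists_baseCoset_eq` — a morphism `ℬ(R)⁰ → 𝒟^{⊚±}` from an object containing `Π_v̲` sends the base coset to a coset of an
  element of `N(Π_{X̲_K})` (the local arrow law (L1): morphisms to `𝒟^{⊚±}` are `Aut(𝒟^{⊚±})`-translates of `φ^{Θell}`);
* **`LocalDatum.labOfHomAmb f`** (kit slot `labOfHom v`) for `f : X ⟶ G.obj`, `X` an ambient object in play, `G : Glob`: `cuspTransport` of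
  the base coset of the marking-reduced morphism `μ_X⁻¹ ≫ f ≫ μ_G`;
* kit laws: **`labOfHomAmb_pre`** (naturality in isomorphisms of the source: `labOfHom (φ ≫ f) = labOfHom f ∘ labMap φ`),
  **`labOfHomAmb_post`** (naturality in isomorphisms `ψ : G ⥲ G'` of `Glob`, for sources IN PLAY: `labOfHom (f ≫ ψ) = gLabMap ψ ∘ labOfHom f`),
  **`labOfHomAmb_phiEll`** (`labOfHom (φ^{Θell}_{•,v̲}) = id` — whence `labOfHom_phiEll_bijective`/`_charts` and (α) `PhiEllSync` at the
  instance: the fixed chart of `𝒟^{⊚±}` and the group chart of `𝒟_v̲` are the SAME chart based at `ε⁰`, (K1)).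
No instance, no notation; typed ≠ proved elsewhere; binder ≠ fact.
-/

noncomputable section

namespace Literature.IUT.HodgeTheaters

open CategoryTheory

universe u v w

section LocalHoms

variable {F : Type u} {K : Type v} {Fbar : Type w} [Field F] [NumberField F] [Field K] [NumberField K]
  [Algebra F K] [Field Fbar] [Algebra F Fbar] [Algebra K Fbar]
  {E : WeierstrassCurve F} [E.IsElliptic] {l : ℕ} {Pb : BadPlacePredicates K}
  {D : InitialThetaData F K Fbar E l Pb} {CG : D.geom.pe.CuspGalois} {hS : D.CuspClassesNormaliserStable} [Fact l.Prime]
  (δ : D.LocalDatum CG hS)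

namespace InitialThetaData

namespace LocalDatum

/-! ### Base cosets of morphisms to `𝒟^{⊚±}` -/

omit [Fact l.Prime] in
/-- The BASE COSET of a morphism `g : ℬ(R)⁰ → 𝒟^{⊚±}` of the ambient: the image `fn g (1·R) ∈ Π_{C_F}/Π_{X̲_K}` (it determines `g`:
`g = (xR ↦ x·d·Π_{X̲_K})` for any `d` in it). ([IUTchI] Ex 6.3 (i) p.161) [claim: Mochizuki2012, status: disputed] -/
def baseCoset {R : Subgroup D.PiC} (g : (OrbitCat.of R : D.PiAmbient) ⟶ D.gModelObj) : D.PiC ⧸ D.PiXund :=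
  OrbitCat.fn g (QuotientGroup.mk 1)

/-- **(L1) on morphisms**: a morphism `ℬ(R)⁰ → 𝒟^{⊚±}` from an object `ℬ(R)⁰` with `Π_v̲ ≤ R` has base coset `d·Π_{X̲_K}` for some
`d ∈ N(Π_{X̲_K})` — it is `φ^{Θell}`-like followed by the automorphism `xΠ ↦ xdΠ` of `𝒟^{⊚±}`. ([IUTchI] Ex 6.3 (i) p.161) [claim: Mochizuki2012, status: disputed] -/
theorem exists_baseCoset_eq {R : Subgroup D.PiC} (hR : δ.H ≤ R) (g : (OrbitCat.of R : D.PiAmbient) ⟶ D.gModelObj) :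
    ∃ d : ↥(Subgroup.normalizer ((D.PiXund : Subgroup D.PiC) : Set D.PiC)),
      baseCoset g = (QuotientGroup.mk (d : D.PiC) : D.PiC ⧸ D.PiXund) := by
  obtain ⟨d, hd, rfl⟩ := OrbitCat.exists_eq_homOfElem g
  have hdN : d ∈ Subgroup.normalizer ((D.PiXund : Subgroup D.PiC) : Set D.PiC) :=
    δ.law.mem_normalizer_of_conj_le d fun x hx => hd x (hR hx)
  refine ⟨⟨d, hdN⟩, ?_⟩
  change (QuotientGroup.mk ((1 : D.PiC) * d) : D.PiC ⧸ D.PiXund) = QuotientGroup.mk d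
  rw [one_mul]

omit [Fact l.Prime] in
/-- The base coset of `a ≫ g` for an automorphism `a = (xR ↦ xnR)`: `n • (base coset of g)`. ([IUTchI] Ex 6.3 (i) p.161) [claim: Mochizuki2012, status: disputed] -/
theorem baseCoset_aut_comp {R : Subgroup D.PiC} {n : D.PiC} (hn : n ∈ Subgroup.normalizer ((R : Subgroup D.PiC) : Set D.PiC))
    (g : (OrbitCat.of R : D.PiAmbient) ⟶ D.gModelObj) :
    baseCoset ((OrbitCat.autOfNormalizer n hn).hom ≫ g) = n • baseCoset (D := D) g := by
  change OrbitCat.fn g (OrbitCat.fn (OrbitCat.autOfNormalizer n hn).hom (QuotientGroup.mk 1)) = n • OrbitCat.fn g (QuotientGroup.mk 1)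
  rw [OrbitCat.fn_autOfNormalizer_hom, one_mul, ← OrbitCat.fn_smul]
  congr 1
  change (QuotientGroup.mk n : D.PiC ⧸ R) = QuotientGroup.mk (n * 1)
  rw [mul_one]

omit [Fact l.Prime] in
/-- The base coset of `g ≫ (xΠ ↦ xmΠ)`: `(base coset of g) · m`. ([IUTchI] Ex 6.3 (i) p.161) [claim: Mochizuki2012, status: disputed] -/
theorem baseCoset_comp_aut {R : Subgroup D.PiC} {m : D.PiC}
    (hm : m ∈ Subgroup.normalizer ((D.PiXund : Subgroup D.PiC) : Set D.PiC))
    (g : (OrbitCat.of R : D.PiAmbient) ⟶ D.gModelObj) {d : D.PiC}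
    (hg : baseCoset g = (QuotientGroup.mk d : D.PiC ⧸ D.PiXund)) :
    baseCoset (g ≫ (OrbitCat.autOfNormalizer m hm).hom) = (QuotientGroup.mk (d * m) : D.PiC ⧸ D.PiXund) := by
  change OrbitCat.fn (OrbitCat.autOfNormalizer m hm).hom (baseCoset g) = _
  rw [hg]
  exact OrbitCat.fn_autOfNormalizer_hom m hm d

/-! ### Kit slot `labOfHom` -/

open Classical in
/-- **Kit slot `labOfHom v`** — the map on `±`-label classes of cusps induced by a morphism `f : †𝒟 → ‡𝒟^{⊚±}` from an object in play to a
global isomorph `G` (Prop 6.5 (i)): the label bijection `cuspTransport` of the base coset of the marking-reduced morphism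
`μ_X⁻¹ ≫ f ≫ μ_G : ℬ(R)⁰ → 𝒟^{⊚±}` (identity on objects not in play — never used). ([IUTchI] Prop 6.5 (i) p.163) [claim: Mochizuki2012, status: disputed] -/
def labOfHomAmb {X : D.PiAmbient} {G : D.Glob} (f : X ⟶ G.obj) : D.geom.pe.Cusp → D.geom.pe.Cusp :=
  if hX : Nonempty (X ≅ δ.locObj) then
    D.cuspTransport CG hS (baseCoset ((δ.locMark X hX).inv ≫ f ≫ (D.gMarking G).hom.hom))
  else if hX' : Nonempty (X ≅ δ.undObj) then
    D.cuspTransport CG hS (baseCoset ((δ.undMark X hX').inv ≫ f ≫ (D.gMarking G).hom.hom))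
  else if hX'' : Nonempty (X ≅ D.gModelObj) then
    D.cuspTransport CG hS (baseCoset ((D.glbMark X hX'').inv ≫ f ≫ (D.gMarking G).hom.hom))
  else id

/-- The local branch. ([IUTchI] Prop 6.5 (i) p.163) [claim: Mochizuki2012, status: disputed] -/
theorem labOfHomAmb_of_loc {X : D.PiAmbient} {G : D.Glob} (f : X ⟶ G.obj) (hX : Nonempty (X ≅ δ.locObj)) :
    δ.labOfHomAmb f =
      D.cuspTransport CG hS (baseCoset ((δ.locMark X hX).inv ≫ f ≫ (D.gMarking G).hom.hom)) := by
  rw [labOfHomAmb, dif_pos hX]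

/-- The `†𝒟^±` branch. ([IUTchI] Prop 6.5 (i) p.163) [claim: Mochizuki2012, status: disputed] -/
theorem labOfHomAmb_of_und {X : D.PiAmbient} {G : D.Glob} (f : X ⟶ G.obj) (hX : ¬ Nonempty (X ≅ δ.locObj))
    (hX' : Nonempty (X ≅ δ.undObj)) :
    δ.labOfHomAmb f =
      D.cuspTransport CG hS (baseCoset ((δ.undMark X hX').inv ≫ f ≫ (D.gMarking G).hom.hom)) := by
  rw [labOfHomAmb, dif_neg hX, dif_pos hX']

/-- The global branch. ([IUTchI] Prop 6.5 (i) p.163) [claim: Mochizuki2012, status: disputed] -/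
theorem labOfHomAmb_of_glb {X : D.PiAmbient} {G : D.Glob} (f : X ⟶ G.obj) (hX : ¬ Nonempty (X ≅ δ.locObj))
    (hX' : ¬ Nonempty (X ≅ δ.undObj)) (hX'' : Nonempty (X ≅ D.gModelObj)) :
    δ.labOfHomAmb f =
      D.cuspTransport CG hS (baseCoset ((D.glbMark X hX'').inv ≫ f ≫ (D.gMarking G).hom.hom)) := by
  rw [labOfHomAmb, dif_neg hX, dif_neg hX', dif_pos hX'']

/-- The junk branch (objects not in play). ([IUTchI] Prop 6.5 (i) p.163) [claim: Mochizuki2012, status: disputed] -/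
theorem labOfHomAmb_of_not {X : D.PiAmbient} {G : D.Glob} (f : X ⟶ G.obj) (hX : ¬ Nonempty (X ≅ δ.locObj))
    (hX' : ¬ Nonempty (X ≅ δ.undObj)) (hX'' : ¬ Nonempty (X ≅ D.gModelObj)) : δ.labOfHomAmb f = id := by
  rw [labOfHomAmb, dif_neg hX, dif_neg hX', dif_neg hX'']

/-! ### The three laws, branch by branch, from ONE computation -/

/-- **Core computation (pre)**: for `g : ℬ(R)⁰ → 𝒟^{⊚±}` with `Π_v̲ ≤ R ≤ Π_{X̲_K}`, `N(R) ≤ N(Π_{X̲_K})`, and an automorphism `a = (xR ↦ xnR)`: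
`cuspTransport (base coset of a ≫ g) = cuspTransport (base coset of g) ∘ subLabAut a`. ([IUTchI] Prop 6.5 (i) p.163) [claim: Mochizuki2012, status: disputed] -/
theorem cuspTransport_baseCoset_aut_comp {R : Subgroup D.PiC} (hR : δ.H ≤ R)
    (hN : Subgroup.normalizer ((R : Subgroup D.PiC) : Set D.PiC) ≤ Subgroup.normalizer ((D.PiXund : Subgroup D.PiC) : Set D.PiC))
    (hle : R ≤ D.PiXund) (a : (OrbitCat.of R : D.PiAmbient) ≅ OrbitCat.of R) (g : (OrbitCat.of R : D.PiAmbient) ⟶ D.gModelObj) :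
    ⇑(D.cuspTransport CG hS (baseCoset (a.hom ≫ g))) =
      ⇑(D.cuspTransport CG hS (baseCoset g)) ∘ ⇑(D.subLabAut CG hS hN hle a) := by
  obtain ⟨n, hn, rfl⟩ := OrbitCat.exists_eq_autOfNormalizer a
  obtain ⟨d, hd⟩ := δ.exists_baseCoset_eq hR g
  rw [baseCoset_aut_comp hn g, hd, D.subLabAut_autOfNormalizer CG hS hN hle n hn, ← Equiv.Perm.coe_mul,
    MulAction.Quotient.smul_mk, smul_eq_mul,
    show n * (d : D.PiC) = ((⟨n, hN hn⟩ * d : ↥(Subgroup.normalizer ((D.PiXund : Subgroup D.PiC) : Set D.PiC))) : D.PiC) from rfl,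
    D.cuspTransport_mk CG hS, D.cuspTransport_mk CG hS, map_mul, mul_inv_rev]

/-- **Core computation (post)**: for `g : ℬ(R)⁰ → 𝒟^{⊚±}` as above and an automorphism `b = (xΠ ↦ xmΠ)` of `𝒟^{⊚±}`:
`cuspTransport (base coset of g ≫ b) = gLabAutModel b ∘ cuspTransport (base coset of g)`. ([IUTchI] Prop 6.5 (i) p.163) [claim: Mochizuki2012, status: disputed] -/
theorem cuspTransport_baseCoset_comp_aut {R : Subgroup D.PiC} (hR : δ.H ≤ R) (g : (OrbitCat.of R : D.PiAmbient) ⟶ D.gModelObj)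
    (b : Aut (D.gModelObj)) :
    ⇑(D.cuspTransport CG hS (baseCoset (g ≫ b.hom))) =
      ⇑(D.gLabAutModel CG hS b) ∘ ⇑(D.cuspTransport CG hS (baseCoset g)) := by
  obtain ⟨m, hm, rfl⟩ := OrbitCat.exists_eq_autOfNormalizer b
  obtain ⟨d, hd⟩ := δ.exists_baseCoset_eq hR g
  rw [baseCoset_comp_aut hm g hd, hd, D.gLabAutModel_autOfNormalizer CG hS m hm, ← Equiv.Perm.coe_mul,
    show (d : D.PiC) * m = ((d * ⟨m, hm⟩ : ↥(Subgroup.normalizer ((D.PiXund : Subgroup D.PiC) : Set D.PiC))) : D.PiC) from rfl,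
    D.cuspTransport_mk CG hS, D.cuspTransport_mk CG hS, map_mul, mul_inv_rev]

omit [Fact l.Prime] in
/-- Marking cancellation on cosets: `fn μ_G⁻¹ (fn μ_G q) = q`. ([IUTchI] Def 6.1 (vi) p.159) [claim: Mochizuki2012, status: disputed] -/
theorem fn_gMarking_inv_fn_hom (G : D.Glob) (q : D.PiC ⧸ (G.obj).sub) :
    OrbitCat.fn (D.gMarking G).inv.hom (OrbitCat.fn (D.gMarking G).hom.hom q) = q := by
  change OrbitCat.fn ((D.gMarking G).hom.hom ≫ (D.gMarking G).inv.hom) q = q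
  rw [ObjectProperty.isoHom_inv_id_hom]
  rfl

omit [Fact l.Prime] in
/-- Splitting the source marking: base coset of `μX⁻¹ ≫ φ ≫ f ≫ μG` versus the reduced automorphism `μX⁻¹ φ μY` followed by
`μY⁻¹ ≫ f ≫ μG`. ([IUTchI] Prop 6.5 (i) p.163) [claim: Mochizuki2012, status: disputed] -/
theorem baseCoset_split_source {R : Subgroup D.PiC} {X Y : D.PiAmbient} {G : D.Glob} (μX : X ≅ OrbitCat.of R) (μY : Y ≅ OrbitCat.of R)
    (φ : X ≅ Y) (f : Y ⟶ G.obj) :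
    baseCoset (μX.inv ≫ (φ.hom ≫ f) ≫ (D.gMarking G).hom.hom) =
      baseCoset ((μX.symm ≪≫ φ ≪≫ μY).hom ≫ μY.inv ≫ f ≫ (D.gMarking G).hom.hom) := by
  change OrbitCat.fn (D.gMarking G).hom.hom (OrbitCat.fn f (OrbitCat.fn φ.hom (OrbitCat.fn μX.inv (QuotientGroup.mk 1)))) =
    OrbitCat.fn (D.gMarking G).hom.hom (OrbitCat.fn f (OrbitCat.fn μY.inv (OrbitCat.fn μY.hom
      (OrbitCat.fn φ.hom (OrbitCat.fn μX.inv (QuotientGroup.mk 1))))))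
  congr 2
  change _ = OrbitCat.fn (μY.hom ≫ μY.inv) (OrbitCat.fn φ.hom (OrbitCat.fn μX.inv (QuotientGroup.mk 1)))
  rw [Iso.hom_inv_id]
  rfl

omit [Fact l.Prime] in
/-- Splitting the target marking: base coset of `μX⁻¹ ≫ f ≫ ψ ≫ μG'` versus `μX⁻¹ ≫ f ≫ μG` followed by the reduced automorphism
`toModelAut ψ = μG⁻¹ ψ μG'` of `𝒟^{⊚±}`. ([IUTchI] Prop 6.5 (i) p.163) [claim: Mochizuki2012, status: disputed] -/
theorem baseCoset_split_target {R : Subgroup D.PiC} {X : D.PiAmbient} {G G' : D.Glob} (μinv : (OrbitCat.of R : D.PiAmbient) ⟶ X)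
    (f : X ⟶ G.obj) (ψ : G ≅ G') :
    baseCoset (μinv ≫ (f ≫ ψ.hom.hom) ≫ (D.gMarking G').hom.hom) =
      baseCoset ((μinv ≫ f ≫ (D.gMarking G).hom.hom) ≫ (D.toModelAut ψ).hom) := by
  change OrbitCat.fn (D.gMarking G').hom.hom (OrbitCat.fn ψ.hom.hom (OrbitCat.fn f (OrbitCat.fn μinv (QuotientGroup.mk 1)))) =
    OrbitCat.fn (D.gMarking G').hom.hom (OrbitCat.fn ψ.hom.hom (OrbitCat.fn (D.gMarking G).inv.hom
      (OrbitCat.fn (D.gMarking G).hom.hom (OrbitCat.fn f (OrbitCat.fn μinv (QuotientGroup.mk 1))))))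
  rw [fn_gMarking_inv_fn_hom]

/-- **Kit law `labOfHom_pre`** (naturality in isomorphisms of the source): `labOfHom (φ ≫ f) = labOfHom f ∘ labMap φ`.
([IUTchI] Prop 6.5 (i) p.163) [claim: Mochizuki2012, status: disputed] -/
theorem labOfHomAmb_pre {X Y : D.PiAmbient} {G : D.Glob} (φ : X ≅ Y) (f : Y ⟶ G.obj) :
    δ.labOfHomAmb (φ.hom ≫ f) = δ.labOfHomAmb f ∘ ⇑(δ.labMapAmb φ) := by
  by_cases hX : Nonempty (X ≅ δ.locObj)
  · have hY : Nonempty (Y ≅ δ.locObj) := ⟨φ.symm ≪≫ hX.some⟩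
    rw [δ.labOfHomAmb_of_loc _ hX, δ.labOfHomAmb_of_loc _ hY, δ.labMapAmb_of_loc φ hX hY, δ.law.locLabAut_eq_subLabAut,
      baseCoset_split_source (δ.locMark X hX) (δ.locMark Y hY) φ f]
    exact δ.cuspTransport_baseCoset_aut_comp le_rfl δ.law.normalizer_le δ.law.le_PiXund _ _
  by_cases hX' : Nonempty (X ≅ δ.undObj)
  · have hY : ¬ Nonempty (Y ≅ δ.locObj) := fun h => hX ⟨φ ≪≫ h.some⟩
    have hY' : Nonempty (Y ≅ δ.undObj) := ⟨φ.symm ≪≫ hX'.some⟩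
    rw [δ.labOfHomAmb_of_und _ hX hX', δ.labOfHomAmb_of_und _ hY hY', δ.labMapAmb_of_und φ hX hX' hY',
      baseCoset_split_source (δ.undMark X hX') (δ.undMark Y hY') φ f]
    exact δ.cuspTransport_baseCoset_aut_comp δ.le_und δ.normalizer_und_le δ.und_le _ _
  by_cases hX'' : Nonempty (X ≅ D.gModelObj)
  · have hY : ¬ Nonempty (Y ≅ δ.locObj) := fun h => hX ⟨φ ≪≫ h.some⟩
    have hY' : ¬ Nonempty (Y ≅ δ.undObj) := fun h => hX' ⟨φ ≪≫ h.some⟩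
    have hY'' : Nonempty (Y ≅ D.gModelObj) := ⟨φ.symm ≪≫ hX''.some⟩
    rw [δ.labOfHomAmb_of_glb _ hX hX' hX'', δ.labOfHomAmb_of_glb _ hY hY' hY'', δ.labMapAmb_of_glb φ hX hX' hX'' hY'',
      D.gLabAutModel_eq_subLabAut CG hS, baseCoset_split_source (D.glbMark X hX'') (D.glbMark Y hY'') φ f]
    exact δ.cuspTransport_baseCoset_aut_comp (δ.le_und.trans δ.und_le) le_rfl le_rfl _ _
  · have hY : ¬ Nonempty (Y ≅ δ.locObj) := fun h => hX ⟨φ ≪≫ h.some⟩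
    have hY' : ¬ Nonempty (Y ≅ δ.undObj) := fun h => hX' ⟨φ ≪≫ h.some⟩
    have hY'' : ¬ Nonempty (Y ≅ D.gModelObj) := fun h => hX'' ⟨φ ≪≫ h.some⟩
    rw [δ.labOfHomAmb_of_not _ hX hX' hX'', δ.labOfHomAmb_of_not _ hY hY' hY'', δ.labMapAmb_of_not φ hX hX' hX'']
    rfl

/-- **Kit law `labOfHom_post`** (naturality in isomorphisms `ψ : G ⥲ G'` of `Glob`): `labOfHom (f ≫ ψ) = gLabMap ψ ∘ labOfHom f`.
([IUTchI] Prop 6.5 (i) p.163) [claim: Mochizuki2012, status: disputed] -/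
theorem labOfHomAmb_post {X : D.PiAmbient} (hXP : δ.InPlay X) {G G' : D.Glob} (f : X ⟶ G.obj) (ψ : G ≅ G') :
    δ.labOfHomAmb (f ≫ ψ.hom.hom) = ⇑(D.gLabIso CG hS ψ) ∘ δ.labOfHomAmb f := by
  by_cases hX : Nonempty (X ≅ δ.locObj)
  · rw [δ.labOfHomAmb_of_loc _ hX, δ.labOfHomAmb_of_loc _ hX, baseCoset_split_target, gLabIso]
    exact δ.cuspTransport_baseCoset_comp_aut le_rfl _ _
  by_cases hX' : Nonempty (X ≅ δ.undObj)
  · rw [δ.labOfHomAmb_of_und _ hX hX', δ.labOfHomAmb_of_und _ hX hX', baseCoset_split_target, gLabIso]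
    exact δ.cuspTransport_baseCoset_comp_aut δ.le_und _ _
  by_cases hX'' : Nonempty (X ≅ D.gModelObj)
  · rw [δ.labOfHomAmb_of_glb _ hX hX' hX'', δ.labOfHomAmb_of_glb _ hX hX' hX'', baseCoset_split_target, gLabIso]
    exact δ.cuspTransport_baseCoset_comp_aut (δ.le_und.trans δ.und_le) _ _
  · exact (hXP.elim hX fun h => h.elim hX' hX'').elim

/-- `φ^{Θell}_{•,v̲}` as a morphism of the AMBIENT: `xΠ_v̲ ↦ xΠ_{X̲_K}`. ([IUTchI] Ex 6.3 (i) p.161) [claim: Mochizuki2012, status: disputed] -/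
def phiEllAmb : δ.locObj ⟶ D.gModelObj :=
  OrbitCat.homOfElem 1 (OrbitCat.one_conj_mem_of_le (δ.le_und.trans δ.und_le))

/-- The kit's `phiEll` is `phiEllAmb` wrapped into the full subcategory. ([IUTchI] Ex 6.3 (i) p.161) [claim: Mochizuki2012, status: disputed] -/
theorem phiEll_hom : (δ.phiEll).hom = δ.phiEllAmb := rfl

/-- **`labOfHom (φ^{Θell}_{•,v̲}) = id`**: on the model morphism the label map is the identity of `Cusp(X̲_K)` — in the Π-avatar the `±`-label
classes of `𝒟_v̲` ARE the cusps of `X̲_K` and `φ^{Θell}_{•,v̲}` is the identity coset map; hence the kit laws `labOfHom_phiEll_bijective`,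
`labOfHom_phiEll_charts` and the law (α) `PhiEllSync` hold at the instance by chart bookkeeping ((K1): both sides use the chart based at `ε⁰`).
([IUTchI] Ex 6.3 (i) p.161) [claim: Mochizuki2012, status: disputed] -/
theorem labOfHomAmb_phiEllAmb : δ.labOfHomAmb (G := D.gModel) δ.phiEllAmb = id := by
  have hX : Nonempty (δ.locObj ≅ δ.locObj) := ⟨Iso.refl _⟩
  rw [δ.labOfHomAmb_of_loc _ hX, δ.locMark_locObj hX, D.gMarking_gModel]
  change ⇑(D.cuspTransport CG hS (QuotientGroup.mk ((1 : D.PiC) * 1))) = id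
  rw [mul_one, show (QuotientGroup.mk (1 : D.PiC) : D.PiC ⧸ D.PiXund) =
      QuotientGroup.mk (((1 : ↥(Subgroup.normalizer ((D.PiXund : Subgroup D.PiC) : Set D.PiC))) : D.PiC)) from rfl,
    D.cuspTransport_mk CG hS, map_one, inv_one, Equiv.Perm.coe_one]

end LocalDatum

end InitialThetaData

end LocalHoms

end Literature.IUT.HodgeTheaters
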